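import Summits.QuantumAdvantage.QuantumAdvantage.Theses.ArithStatLadder
import Summits.QuantumAdvantage.QuantumAdvantage.Theorems.ArithStatLadderIqThreeNotPPoly
import Summits.QuantumAdvantage.QuantumAdvantage.Theorems.ArithStatLadderIqThreeNotPPolyStubSamplerNG
import Summits.QuantumAdvantage.QuantumAdvantage.Theorems.ArithStatLadderIqThreeNotPPolyStubOneSidedNG
import Summits.QuantumAdvantage.QuantumAdvantage.Theorems.ArithStatLadderIqThreeNotPPolyStubFundDensityNG
import Summits.QuantumAdvantage.QuantumAdvantage.Theorems.ArithStatLadderIqThreeNotPPolyStubNagellHit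
import Literature.Computability.Cryptography.HallgrenClassGroup
import Literature.Computability.Complexity.StackWords

/-!
# Crux `ArithStatLadder.IqThreeNotPPoly` (stmt-QuantumAdvantage-2422): SQUAREFREE-FILTER DOMINATION, CFT-free

The conclusion of line `Sketch`, skeleton v4 (gen-1 lead `prover-line-stmt-QuantumAdvantage-2422-1`).
Version v3 of this line (file `ArithStatLadderIqThreeNotPPoly.lean`) proved
`IQ3 ∈ P/poly → SQUAREFREES ∈ P/poly` MODULO Hasse's class-field-theoretic dictionary
(`#Cl₃(D) = 2·#{cubic fields of disc D} + 1`, an unproved named fact). Here the same domination is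
proved UNCONDITIONALLY, by replacing the planted family of binary cubic forms with NAGELL's
elementary 3-torsion (Nagell 1922):

* the sampler: on a numeral `x = bin N` and a seed `r`, `k = ⟦r⟧`, put `c = 1 + 2^30 N^5`,
  `s = 1 + 6cNk` and output `bin (N s (4c³ − N s))` (`stub_samplerNG`: the map is in `FP`;
  `stub_natAdapter`: guard non-numerals);
* NO side, exact: `N` not squarefree ⇒ `p² ∣ N ⇒ p² ∣ d` (`16 ∣ d` at `p = 2`) ⇒ `−d` is never
  fundamental (`stub_oneSidedNG`);
* YES side: for squarefree `N` of bit-length `n ≥ n₀`, at least `1/4` of the `k < 2^{8n+48}` give a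
  fundamental `−d` (`stub_fundDensityNG`, from the elementary squarefree sieve in arithmetic
  progressions `stub_apSieve`); and for those `d = 4c⁶ − (2c³ − N s)² = 4a³ − B²` with `a = c²`,
  `gcd(a, B) = 1`, `4a < d`, so the ideal `(a, (B + √−d)/2)` has order `3` in `Cl(ℚ(√−d))` and
  `3 ∣ h(−d)` (`stub_nagellHit`), i.e. `d ∈ S`;
* closure of `P/poly` under one-sided randomized reductions (`mem_PPoly_of_rurReduction`, Adleman).

Theorems (sorry-free; no named-fact hypothesis):
* `sqfree_mem_PPoly_of_iqThree_mem_PPoly` — **`IQ3 ∈ P/poly → SQUAREFREES ∈ P/poly`**;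
* `iqThreeNotPPoly_of_sqfreeNotPPoly` — **the crux follows from the apex "SQUAREFREES ∉ P/poly"**
  (hypothesis-type, Adleman–McCurley open problem O8 non-uniformly; CONDITIONAL theorem about the
  route decl, by name — the line's one remaining socket);
* `sqfree_mem_PPoly_of_not_iqThreeNotPPoly` — **the refutation floor**: any refutation of the crux
  puts SQUAREFREES in `P/poly`, unconditionally.
-/

set_option linter.dupNamespace false -- D-0017: single-problem summit ⇒ `QuantumAdvantage.QuantumAdvantage` by design

noncomputable section

namespace Summit.QuantumAdvantage.QuantumAdvantage.Theorems.IqThreeNotPPoly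

open scoped Classical
open _root_.Computability Literature.Computability.Complexity
open Literature.Computability.Cryptography (IsNegFundamentalDiscr)
open Literature.NumberTheory.QuadraticFields (BinaryQuadraticForm.classNumber)
open Summit.QuantumAdvantage.QuantumAdvantage.Theses.ArithStatLadder (IqThreeNotPPoly)

/-- A fundamental seed of the Nagell family lands in the crux's set `S` (`stub_nagellHit`).
[cite: Nagell1922, §1] -/
theorem nagellD_mem_iqThreeSet (N k : ℕ)
    (hfund : IsNegFundamentalDiscr (N * (1 + 6 * (1 + 2 ^ 30 * N ^ 5) * N * k) *
      (4 * (1 + 2 ^ 30 * N ^ 5) ^ 3 - N * (1 + 6 * (1 + 2 ^ 30 * N ^ 5) * N * k)))) :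
    N * (1 + 6 * (1 + 2 ^ 30 * N ^ 5) * N * k) *
        (4 * (1 + 2 ^ 30 * N ^ 5) ^ 3 - N * (1 + 6 * (1 + 2 ^ 30 * N ^ 5) * N * k)) ∈
      {d : ℕ | IsNegFundamentalDiscr d ∧ 3 ∣ BinaryQuadraticForm.classNumber (-(d : ℤ))} :=
  ⟨hfund, stub_nagellHit N k hfund⟩

/-- **`IQ3 ∈ P/poly → SQUAREFREES ∈ P/poly`, unconditionally.** The one-sided randomized
reduction `SQF ≤ IQ3` of line `Sketch` v4 — Nagell sampler `stub_samplerNG` guarded by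
`stub_natAdapter`, exact NO side `stub_oneSidedNG`, YES-density `≥ 1/4` from `stub_fundDensityNG`,
hits certified by `stub_nagellHit` — fed to `mem_PPoly_of_rurReduction` with seed length
`ℓ(n) = 8n + 48` and success polynomial `8 X + 48`. [cite: Nagell1922, §1] -/
theorem sqfree_mem_PPoly_of_iqThree_mem_PPoly
    (hIQ : encodingNatBool.toLanguage
      {d : ℕ | IsNegFundamentalDiscr d ∧ 3 ∣ BinaryQuadraticForm.classNumber (-(d : ℤ))} ∈ PPoly) :
    encodingNatBool.toLanguage {m : ℕ | Squarefree m} ∈ PPoly := by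
  obtain ⟨f, hf, hfval⟩ := stub_samplerNG
  obtain ⟨f', hf', hcanon, hjunk⟩ := stub_natAdapter f hf []
  obtain ⟨n₀, hdens⟩ := stub_fundDensityNG
  refine mem_PPoly_of_rurReduction (encodingNatBool.toLanguage {m : ℕ | Squarefree m})
    (encodingNatBool.toLanguage
      {d : ℕ | IsNegFundamentalDiscr d ∧ 3 ∣ BinaryQuadraticForm.classNumber (-(d : ℤ))})
    f' hf' (fun n => 8 * n + 48) (8 * Polynomial.X + 48) n₀ (fun n => ?_) ?_ ?_ hIQ
  · simp only [Polynomial.eval_add, Polynomial.eval_mul, Polynomial.eval_ofNat, Polynomial.eval_X]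
    omega
  · -- NO side (exact): non-squarefree numerals by `stub_oneSidedNG`, non-numerals by the guard
    intro x hx r
    by_cases hcx : ∃ m : ℕ, encodeNat m = x
    · obtain ⟨m, rfl⟩ := hcx
      have hm : ¬ Squarefree m := fun h =>
        hx ((encodeNat_mem_toLanguage_iff {m : ℕ | Squarefree m} m).2 h)
      rw [hcanon, hfval, bitsToNat_encodeNat, encodeNat_mem_toLanguage_iff]
      rintro ⟨hfund, -⟩
      exact stub_oneSidedNG m (bitsToNat r) hm hfund
    · rw [hjunk x r (fun m hm => hcx ⟨m, hm⟩)]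
      exact nil_not_mem_iqThreeLanguage
  · -- YES side (density ≥ 1/4), and fundamental seeds are in `S`
    intro x hx hn
    obtain ⟨N, hN, hNx⟩ := hx
    change encodeNat N = x at hNx
    subst hNx
    have hsq : Squarefree N := hN
    have h := hdens (encodeNat N).length hn N hsq rfl
    have hq : 4 ≤ (8 * Polynomial.X + 48 : Polynomial ℕ).eval (encodeNat N).length := by
      simp only [Polynomial.eval_add, Polynomial.eval_mul, Polynomial.eval_ofNat, Polynomial.eval_X]
      omega
    refine h.trans ((Nat.mul_le_mul_right _ hq).trans (Nat.mul_le_mul_left _ ?_))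
    rw [← card_filter_seeds (8 * (encodeNat N).length + 48) (fun k =>
      IsNegFundamentalDiscr (N * (1 + 6 * (1 + 2 ^ 30 * N ^ 5) * N * k) *
        (4 * (1 + 2 ^ 30 * N ^ 5) ^ 3 - N * (1 + 6 * (1 + 2 ^ 30 * N ^ 5) * N * k))))]
    refine Finset.card_le_card fun r hr => ?_
    rw [Finset.mem_filter] at hr ⊢
    refine ⟨Finset.mem_univ _, ?_⟩
    rw [hcanon, hfval, bitsToNat_encodeNat, encodeNat_mem_toLanguage_iff]
    exact nagellD_mem_iqThreeSet N _ hr.2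

/-- **The crux from the apex: `SQUAREFREES ∉ P/poly → IqThreeNotPPoly`**, with NO other hypothesis
(v3's class-field-theory input is gone). CONDITIONAL theorem on the route decl, by name; the apex
"squarefreeness has no polynomial-size circuits" is hypothesis-type (Adleman–McCurley O8,
non-uniformly) and is the line's single remaining socket. [cite: Nagell1922, §1] -/
theorem iqThreeNotPPoly_of_sqfreeNotPPoly :
    encodingNatBool.toLanguage {m : ℕ | Squarefree m} ∉ PPoly → IqThreeNotPPoly :=
  fun hX hIQ => hX (sqfree_mem_PPoly_of_iqThree_mem_PPoly hIQ)

/-- **The refutation floor, unconditional**: a refutation of the crux (polynomial-size circuits for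
`IQ3`) yields polynomial-size circuits for SQUAREFREENESS. [cite: Nagell1922, §1] -/
theorem sqfree_mem_PPoly_of_not_iqThreeNotPPoly (h : ¬ IqThreeNotPPoly) :
    encodingNatBool.toLanguage {m : ℕ | Squarefree m} ∈ PPoly :=
  sqfree_mem_PPoly_of_iqThree_mem_PPoly (not_not.1 h)

end Summit.QuantumAdvantage.QuantumAdvantage.Theorems.IqThreeNotPPoly

end
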